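import Mathlib.Analysis.SpecialFunctions.Log.Basic
import HarnessLib

/-!
# The case analysis and bookkeeping of Hamilton's Thm. 2.3, as real inequalities
(topic `Geometry/Riemannian`)

Part of the decomposition of `Literature.Geometry.Riemannian.hamilton_chenZhu_pinching`
(`PinchingEstimates.lean`), towards the ODE part of Hamilton 1997, Thm. 2.3 (pp. 17–20):
preservation of `b₃ ≤ (1 + L e^{Pt}/max{ln u, Q}) u`, `u = √((a₁+ρ)(c₁+ρ))`. Hamilton compares
the new ratio `μ = b₃/u` with the ratio `λ = 2b₃/√((a₁+a₂)(c₁+c₂))` of Thm. 2.1 in two cases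
(p. 17: "`(a₁+a₂)/(a₁+ρ) ≤ 2[1 + δ(μ-1)]` and the same for `c`", or not), and in the second case
runs the boundary computation of pp. 18–20 ("`(μ-1)²(D+E) ≤ μ L e^{Pt} E` … it suffices to have
`L` big"). PROVED here as inequalities between real numbers, with explicit constants, in the
form consumed by the barrier argument of `PinchingEstimatesImprovingQ.lean` (where
`κ = L e^{Pt}/ln u ≤ μ - 1` at a minimiser, `ℓ` is the exact value of `d/dt ln u` and
`D = a₃ + c₃ + |ᵗBw| + |Bz| ≥ d/dt ln b₃`):

* `upsilon_le_a₃`, `upsilon_le_x`, `XA_le_upsilon` — the comparabilities "`a₃` is at least a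
  fraction of `u`", "`u ≤ Cx`", "`a₁ + ρ ≤ Cu`" (p. 18, p. 20) from the pinching constants;
* `caseA_absurd` — in Hamilton's first case the inequality holds strictly inside
  (`μ - 1 ≤ 2(λ-1) ≤ 2K/max{ln x, 2} < L/ln u ≤ κ`), so a minimiser with `G ≤ 0` is in the
  second case once `L > K(C₁ + 2)`;
* `lemma23` — in the second case, `κ² ℓ ≤ L e^{Pt} (1 + κ)(ℓ - D)` for `L ≥ L₀(m, ρ, Ω, K)`.

## References

* R. S. Hamilton, *Four-manifolds with positive isotropic curvature*, Comm. Anal. Geom. 5 (1997)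
  1–92, §2.2, Thm. 2.3 and its proof (pp. 17–20). [Hamilton1997]
-/

noncomputable section

open Real

namespace Literature.Geometry.Riemannian

namespace HamiltonODE

/-! ### Comparabilities from the pinching constants -/

/-- **`u ≤ C₃ a₃`** with `C₃ = C₄(ΩC₄ + 2ρ/m + 1)`, `C₄ = 1 + 2ρ/m` (Hamilton, p. 18: "`a₃` is at
least a fraction of `u`"): from `u² = (a₁+ρ)(c₁+ρ)`, `a₁ ≤ a₃`, `c₁ ≤ c₃ ≤ Ω(a₁+ρ)`, `a₃ ≥ m/2`.
[cite: Hamilton1997, §2.2, Thm. 2.3 (proof, p. 18)] -/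
theorem upsilon_le_a₃ {a₁ a₃ c₁ c₃ ρ Ω m υ : ℝ} (hm : 0 < m) (hρ : 0 < ρ) (hΩ : 0 < Ω)
    (ha : a₁ ≤ a₃) (hc : c₁ ≤ c₃) (ha₃m : m / 2 ≤ a₃) (hXA : 0 < a₁ + ρ)
    (hc₃A : c₃ ≤ Ω * (a₁ + ρ)) (hυ2 : υ ^ 2 = (a₁ + ρ) * (c₁ + ρ)) :
    υ ≤ (1 + 2 * ρ / m) * (Ω * (1 + 2 * ρ / m) + 2 * ρ / m + 1) * a₃ := by
  set C₄ := 1 + 2 * ρ / m with hC₄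
  have ha₃ : 0 < a₃ := by linarith only [ha₃m, hm]
  have hρm : ρ ≤ 2 * ρ / m * a₃ := by
    rw [div_mul_eq_mul_div, le_div_iff₀ hm]; nlinarith only [ha₃m, hρ]
  have h1 : a₁ + ρ ≤ C₄ * a₃ := by rw [hC₄]; linarith only [ha, hρm]
  have h2 : c₁ + ρ ≤ (Ω * C₄ + 2 * ρ / m) * a₃ := by
    have : c₁ + ρ ≤ Ω * (a₁ + ρ) + ρ := by linarith only [hc, hc₃A]
    nlinarith only [this, h1, hΩ, hρm]
  have hC₄1 : 1 ≤ C₄ := by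
    have : (0 : ℝ) ≤ 2 * ρ / m := by positivity
    rw [hC₄]; linarith only [this]
  have hE0 : 0 ≤ Ω * C₄ + 2 * ρ / m := by positivity
  have h3 : υ ^ 2 ≤ (C₄ * (Ω * C₄ + 2 * ρ / m + 1) * a₃) ^ 2 := by
    rw [hυ2]
    have hXC : 0 ≤ c₁ + ρ := by
      rcases le_or_gt 0 (c₁ + ρ) with h | h
      · exact h
      · nlinarith only [hυ2, hXA, h, sq_nonneg υ]
    calc (a₁ + ρ) * (c₁ + ρ) ≤ (C₄ * a₃) * ((Ω * C₄ + 2 * ρ / m) * a₃) :=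
          mul_le_mul h1 h2 hXC (by positivity)
      _ ≤ (C₄ * (Ω * C₄ + 2 * ρ / m + 1) * a₃) ^ 2 := by
          have h4 : C₄ * (Ω * C₄ + 2 * ρ / m) ≤ (C₄ * (Ω * C₄ + 2 * ρ / m + 1)) ^ 2 := by
            nlinarith only [hC₄1, hE0]
          nlinarith only [h4, sq_nonneg a₃]
  exact le_of_sq_le_sq h3 (by positivity)

/-- **`u ≤ (1 + ρ/m) x`** (Hamilton, p. 18: "`a₁+ρ, c₁+ρ` are at most a multiple … this makes
`u ≤ Cx`"): `a₁ + ρ ≤ (½ + ρ/m)(a₁+a₂)` since `a₁ ≤ a₂` and `a₁ + a₂ ≥ m`.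
[cite: Hamilton1997, §2.2, Thm. 2.3 (proof, p. 18)] -/
theorem upsilon_le_x {a₁ a₂ c₁ c₂ ρ m υ x : ℝ} (hm : 0 < m) (hρ : 0 < ρ) (ha : a₁ ≤ a₂)
    (hc : c₁ ≤ c₂) (hαm : m ≤ a₁ + a₂) (hγm : m ≤ c₁ + c₂) (hXC : 0 < c₁ + ρ)
    (hυ2 : υ ^ 2 = (a₁ + ρ) * (c₁ + ρ)) (hx2 : x ^ 2 = (a₁ + a₂) * (c₁ + c₂)) (hx : 0 < x) :
    υ ≤ (1 + ρ / m) * x := by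
  have hρα : ρ ≤ ρ / m * (a₁ + a₂) := by
    rw [div_mul_eq_mul_div, le_div_iff₀ hm]; nlinarith only [hαm, hρ]
  have hργ : ρ ≤ ρ / m * (c₁ + c₂) := by
    rw [div_mul_eq_mul_div, le_div_iff₀ hm]; nlinarith only [hγm, hρ]
  have h1 : a₁ + ρ ≤ (1 + ρ / m) * (a₁ + a₂) := by nlinarith only [ha, hρα, hαm, hm]
  have h2 : c₁ + ρ ≤ (1 + ρ / m) * (c₁ + c₂) := by nlinarith only [hc, hργ, hγm, hm]
  have h3 : υ ^ 2 ≤ ((1 + ρ / m) * x) ^ 2 := by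
    rw [hυ2, mul_pow, hx2]
    have h0 : 0 ≤ (1 + ρ / m) * (a₁ + a₂) := mul_nonneg (by positivity) (by linarith only [hαm, hm])
    nlinarith only [mul_le_mul h1 h2 hXC.le h0, hαm, hγm, hm]
  exact le_of_sq_le_sq h3 (by positivity)

/-- **`a₁ + ρ ≤ (C₅ + 1) u`**, `C₅ = Ω + 2Ωρ/m`: `a₁ + ρ ≤ a₃ + ρ ≤ Ω(c₁+ρ) + ρ ≤ C₅(c₁+ρ)`
(as `c₁ + ρ ≥ c₃/Ω ≥ m/(2Ω)`), and `(a₁+ρ)² ≤ C₅ u²`. [folklore] -/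
theorem XA_le_upsilon {a₁ a₃ c₁ c₃ ρ Ω m υ : ℝ} (hm : 0 < m) (hρ : 0 < ρ) (hΩ : 0 < Ω)
    (ha : a₁ ≤ a₃) (hc₃m : m / 2 ≤ c₃) (hXA : 0 < a₁ + ρ) (hXC : 0 < c₁ + ρ)
    (ha₃C : a₃ ≤ Ω * (c₁ + ρ)) (hc₃C : c₃ ≤ Ω * (c₁ + ρ)) (hυ2 : υ ^ 2 = (a₁ + ρ) * (c₁ + ρ))
    (hυ : 0 < υ) : a₁ + ρ ≤ (Ω + 2 * Ω * ρ / m + 1) * υ := by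
  have hρC : ρ ≤ 2 * Ω * ρ / m * (c₁ + ρ) := by
    rw [div_mul_eq_mul_div, le_div_iff₀ hm]; nlinarith only [hc₃m, hc₃C, hρ, hΩ]
  have h1 : a₁ + ρ ≤ (Ω + 2 * Ω * ρ / m) * (c₁ + ρ) := by nlinarith only [ha, ha₃C, hρC]
  have h2 : (a₁ + ρ) ^ 2 ≤ ((Ω + 2 * Ω * ρ / m + 1) * υ) ^ 2 := by
    rw [mul_pow, hυ2]
    have h3 : (a₁ + ρ) * (a₁ + ρ) ≤ (Ω + 2 * Ω * ρ / m) * ((a₁ + ρ) * (c₁ + ρ)) := by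
      nlinarith only [h1, hXA]
    have h4 : Ω + 2 * Ω * ρ / m ≤ (Ω + 2 * Ω * ρ / m + 1) ^ 2 := by
      have : 0 ≤ Ω + 2 * Ω * ρ / m := by positivity
      nlinarith only [this]
    nlinarith only [h3, h4, mul_pos hXA hXC]
  exact le_of_sq_le_sq h2 (by positivity)

/-! ### Hamilton's first case is strictly inside the set -/

/-- **Case A of Thm. 2.3** (Hamilton, pp. 17–18): if `(a₁+a₂) u ≤ 2(u + δt)(a₁+ρ)` and
`(c₁+c₂) u ≤ 2(u + δt)(c₁+ρ)` with `t = Y - u ≥ κ u` (`κ = K_t/ln u`), `δ = 1/(2 + K⁺)`, the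
Thm. 2.1 bound `2Y ≤ (1 + K/max{ln x, 2}) x` and `ln u ≤ C₁ - 1 + max{ln x, 2}`, then
`L · max{ln x, 2} ≤ K⁺ (C₁ + 2) max{ln x, 2}/…` — precisely, `L ≤ K⁺(C₁ + 2)`; so for
`L > K⁺(C₁ + 2)` this case does not occur. [cite: Hamilton1997, §2.2, Thm. 2.3 (proof, pp. 17–18)] -/
theorem caseA_absurd {a₁ a₂ c₁ c₂ ρ K L Ks ℓn κ Y υ x C₁ : ℝ}
    (hγ : 0 < c₁ + c₂) (hXA : 0 < a₁ + ρ) (hυ2 : υ ^ 2 = (a₁ + ρ) * (c₁ + ρ)) (hυ : 0 < υ)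
    (hx2 : x ^ 2 = (a₁ + a₂) * (c₁ + c₂)) (hx : 0 < x)
    (h21 : 2 * Y ≤ (1 + K / max (log x) 2) * x) (hℓn : 2 ≤ ℓn) (hκ : κ = Ks / ℓn)
    (hKs : L ≤ Ks) (hμ : (1 + κ) * υ ≤ Y) (hC₁ : 1 ≤ C₁) (hℓnx : ℓn ≤ C₁ - 1 + max (log x) 2)
    (hL : max K 0 * (C₁ + 2) < L)
    (hA : (a₁ + a₂) * υ ≤ 2 * (υ + (Y - υ) / (2 + max K 0)) * (a₁ + ρ))
    (hC : (c₁ + c₂) * υ ≤ 2 * (υ + (Y - υ) / (2 + max K 0)) * (c₁ + ρ)) : False := by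
  set Kp := max K 0 with hKp
  have hKp0 : 0 ≤ Kp := le_max_right _ _
  have hKK : K ≤ Kp := le_max_left _ _
  set M := max (log x) 2 with hM
  have hM2 : 2 ≤ M := le_max_right _ _
  have hM0 : 0 < M := by linarith only [hM2]
  set t := Y - υ with ht
  have hℓn0 : 0 < ℓn := by linarith only [hℓn]
  have hκ0 : 0 ≤ κ := by rw [hκ]; exact div_nonneg (by linarith only [hKs, hL, mul_nonneg hKp0 (by linarith only [hC₁] : (0:ℝ) ≤ C₁ + 2)]) hℓn0.le
  have htκ : κ * υ ≤ t := by rw [ht]; linarith only [hμ]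
  have ht0 : 0 ≤ t := (mul_nonneg hκ0 hυ.le).trans htκ
  -- `x ≤ 2(υ + δ t)`
  set s := υ + t / (2 + Kp) with hs
  have hs0 : 0 < s := by rw [hs]; positivity
  have hxs : x ≤ 2 * s := by
    have h1 : x ^ 2 * υ ^ 2 ≤ (2 * s) ^ 2 * υ ^ 2 := by
      have hγ0 : 0 ≤ (c₁ + c₂) * υ := by positivity
      have := mul_le_mul hA hC hγ0 (by positivity)
      calc x ^ 2 * υ ^ 2 = ((a₁ + a₂) * υ) * ((c₁ + c₂) * υ) := by rw [hx2]; ring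
        _ ≤ (2 * s * (a₁ + ρ)) * (2 * s * (c₁ + ρ)) := this
        _ = (2 * s) ^ 2 * υ ^ 2 := by rw [hυ2]; ring
    have h2 : x ^ 2 ≤ (2 * s) ^ 2 := le_of_mul_le_mul_right h1 (by positivity)
    exact le_of_sq_le_sq h2 (by positivity)
  -- `λ = 2Y/x ≤ 1 + K⁺/M`, so `Y ≤ (1 + K⁺/M) s` and `t(1 - λδ) ≤ (λ - 1) υ`
  have hlam : 2 * Y ≤ (1 + Kp / M) * x := by
    have : K / M ≤ Kp / M := div_le_div_of_nonneg_right hKK hM0.le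
    nlinarith only [h21, this, hx]
  have hYs : Y ≤ (1 + Kp / M) * s := by
    have : 0 ≤ 1 + Kp / M := by positivity
    nlinarith only [hlam, hxs, this]
  -- `δ (1 + K⁺/M) ≤ 1/2`
  have hdl : (1 + Kp / M) / (2 + Kp) ≤ 1 / 2 := by
    rw [div_le_iff₀ (by positivity)]
    have : Kp / M ≤ Kp / 2 := div_le_div_of_nonneg_left hKp0 (by norm_num) hM2
    linarith only [this]
  have ht2 : t ≤ 2 * (Kp / M) * υ := by
    -- `Y = υ + t ≤ (1 + K⁺/M)(υ + t/(2+K⁺))`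
    have h1 : υ + t ≤ (1 + Kp / M) * υ + (1 + Kp / M) / (2 + Kp) * t := by
      have e : (1 + Kp / M) * s = (1 + Kp / M) * υ + (1 + Kp / M) / (2 + Kp) * t := by
        rw [hs]; ring
      linarith only [hYs, e, ht]
    nlinarith only [h1, hdl, ht0]
  -- compare with `t ≥ κ υ = Ks υ / ℓn ≥ L υ / ℓn`
  have h3 : L * υ / ℓn ≤ 2 * (Kp / M) * υ := by
    have h4 : L * υ / ℓn ≤ κ * υ := by
      rw [hκ, div_mul_eq_mul_div]
      exact div_le_div_of_nonneg_right (by nlinarith only [hKs, hυ]) hℓn0.le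
    linarith only [h4, htκ, ht2]
  have h5 : L * M ≤ 2 * Kp * ℓn := by
    rw [div_le_iff₀ hℓn0] at h3
    have h6 : L ≤ 2 * (Kp / M) * ℓn := le_of_mul_le_mul_right (by nlinarith only [h3]) hυ
    have := mul_le_mul_of_nonneg_right h6 hM0.le
    rwa [show 2 * (Kp / M) * ℓn * M = 2 * Kp * ℓn by field_simp] at this
  have h7 : 2 * Kp * ℓn ≤ Kp * (C₁ + 2) * M := by
    have h8 : ℓn ≤ (C₁ + 2) / 2 * M := by nlinarith only [hℓnx, hM2, hC₁]
    nlinarith only [h8, hKp0]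
  have h9 : L * M ≤ Kp * (C₁ + 2) * M := h5.trans h7
  have := lt_of_le_of_lt (le_of_mul_le_mul_right h9 hM0) hL
  exact lt_irrefl _ this

/-! ### The second case: Hamilton's boundary computation -/

/-- **Thm. 2.3, second case, bookkeeping** (Hamilton, pp. 18–20, with explicit constants). With
`ℓ = ½[(a₁² + S_A + 2a₂a₃)/(a₁+ρ) + (c₁² + S_C + 2c₂c₃)/(c₁+ρ)]` the exact value of
`d/dt ln u` at the extremal vectors (`S_A = |ᵗBw|²`, `S_C = |Bz|²`), `D = a₃ + c₃ + |ᵗBw| + |Bz|`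
(an upper bound for `d/dt ln b₃`), `κ = K_t/ln u` with `(1+κ)u ≤ Y ≤ Ωu`, and in Hamilton's
second case `(a₁+a₂)u > 2(u + δt)(a₁+ρ)` or `(c₁+c₂)u > 2(u + δt)(c₁+ρ)` (`t = Y - u`,
`δ = 1/(2+K⁺)`): for `L` beyond an explicit `L₀(m, ρ, Ω, K)`, `κ² ℓ ≤ K_t (1 + κ)(ℓ - D)`.
[cite: Hamilton1997, §2.2, Thm. 2.3 (proof, pp. 18–20)] -/
theorem lemma23 {a₁ a₂ a₃ c₁ c₂ c₃ bw bz ρ Ω K L Ks ℓn κ Y υ m ℓ D : ℝ} (hm : 0 < m)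
    (hρ : 0 < ρ) (hΩ : 0 < Ω) (ha₁₂ : a₁ ≤ a₂) (ha₂₃ : a₂ ≤ a₃) (hc₁₂ : c₁ ≤ c₂)
    (hc₂₃ : c₂ ≤ c₃) (hαm : m ≤ a₁ + a₂) (hγm : m ≤ c₁ + c₂) (hXA : 0 < a₁ + ρ)
    (hXC : 0 < c₁ + ρ) (hυ2 : υ ^ 2 = (a₁ + ρ) * (c₁ + ρ)) (hυ : 0 < υ) (hY : 0 < Y)
    (hbw : 0 ≤ bw) (hbz : 0 ≤ bz) (hbwY : bw ≤ Y) (hbzY : bz ≤ Y)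
    (ha₃A : a₃ ≤ Ω * (a₁ + ρ)) (ha₃C : a₃ ≤ Ω * (c₁ + ρ)) (hc₃A : c₃ ≤ Ω * (a₁ + ρ))
    (hc₃C : c₃ ≤ Ω * (c₁ + ρ)) (hYA : Y ≤ Ω * (a₁ + ρ)) (hYC : Y ≤ Ω * (c₁ + ρ))
    (hℓn : 2 ≤ ℓn) (hℓnυ : ℓn ≤ υ) (hκ : κ = Ks / ℓn) (hKs : L ≤ Ks) (hL0 : 0 < L)
    (hμ : (1 + κ) * υ ≤ Y)
    (hL1 : (2 + max K 0) * ((1 + 2 * ρ / m) * (Ω * (1 + 2 * ρ / m) + 2 * ρ / m + 1)) *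
      (8 * Ω * ρ) ≤ L)
    (hL2 : (2 + max K 0) * ((1 + 2 * ρ / m) * (Ω * (1 + 2 * ρ / m) + 2 * ρ / m + 1)) *
      (4 * Ω * (4 * Ω * (Ω + 2 * Ω * ρ / m + 2))) ≤ L)
    (hB : 2 * (υ + (Y - υ) / (2 + max K 0)) * (a₁ + ρ) < (a₁ + a₂) * υ ∨
      2 * (υ + (Y - υ) / (2 + max K 0)) * (c₁ + ρ) < (c₁ + c₂) * υ)
    (hℓ : ℓ = ((a₁ ^ 2 + bw ^ 2 + 2 * a₂ * a₃) / (a₁ + ρ) + (c₁ ^ 2 + bz ^ 2 + 2 * c₂ * c₃) / (c₁ + ρ)) / 2)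
    (hD : D = a₃ + c₃ + bw + bz) :
    κ ^ 2 * ℓ ≤ Ks * (1 + κ) * (ℓ - D) := by
  -- constants
  set Kp := max K 0 with hKp
  have hKp0 : 0 ≤ Kp := le_max_right _ _
  set C₃ := (1 + 2 * ρ / m) * (Ω * (1 + 2 * ρ / m) + 2 * ρ / m + 1) with hC₃
  set C₅ := Ω + 2 * Ω * ρ / m with hC₅
  set CD := 4 * Ω * (C₅ + 2) with hCD
  have hC₃0 : 0 < C₃ := by positivity
  have hδ0 : 0 < 2 + Kp := by positivity
  -- positivity of `a₃, c₃`; the ratio `κ ≤ Ω - 1`; `Ks ≥ L`; `κ υ ≥ Ks`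
  have ha₃m : m / 2 ≤ a₃ := by linarith only [ha₁₂, ha₂₃, hαm]
  have hc₃m : m / 2 ≤ c₃ := by linarith only [hc₁₂, hc₂₃, hγm]
  have ha₃ : 0 < a₃ := by linarith only [ha₃m, hm]
  have hc₃ : 0 < c₃ := by linarith only [hc₃m, hm]
  have hℓn0 : 0 < ℓn := by linarith only [hℓn]
  have hKs0 : 0 < Ks := hL0.trans_le hKs
  have hκ0 : 0 < κ := by rw [hκ]; exact div_pos hKs0 hℓn0
  have hYυ : Y ≤ Ω * υ := by
    have h1 : Y ^ 2 ≤ (Ω * υ) ^ 2 := by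
      rw [mul_pow, hυ2]; nlinarith only [mul_le_mul hYA hYC hY.le (by positivity), hΩ]
    exact le_of_sq_le_sq h1 (by positivity)
  have hκΩ : κ ≤ Ω := by nlinarith only [hμ, hYυ, hυ, hκ0]
  have hκKs : κ ≤ Ks / 2 := by
    rw [hκ]; exact div_le_div_of_nonneg_left hKs0.le (by norm_num) hℓn
  have hκυ : Ks ≤ κ * υ := by
    rw [hκ, div_mul_eq_mul_div, le_div_iff₀ hℓn0]; nlinarith only [hℓnυ, hKs0]
  -- `u ≤ C₃ a₃`, `u ≤ C₃ c₃`, `D ≤ CD u`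
  have hυa : υ ≤ C₃ * a₃ := upsilon_le_a₃ hm hρ hΩ (ha₁₂.trans ha₂₃) (hc₁₂.trans hc₂₃) ha₃m hXA hc₃A hυ2
  have hυc : υ ≤ C₃ * c₃ := by
    have h := upsilon_le_a₃ (υ := υ) hm hρ hΩ (hc₁₂.trans hc₂₃) (ha₁₂.trans ha₂₃) hc₃m hXC ha₃C
      (by rw [hυ2]; ring)
    exact h
  have hXAυ : a₁ + ρ ≤ (C₅ + 1) * υ := by
    have := XA_le_upsilon hm hρ hΩ (ha₁₂.trans ha₂₃) hc₃m hXA hXC ha₃C hc₃C hυ2 hυ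
    rw [hC₅]; linarith only [this]
  have hXCυ : c₁ + ρ ≤ (C₅ + 1) * υ := by
    have := XA_le_upsilon (υ := υ) hm hρ hΩ (hc₁₂.trans hc₂₃) ha₃m hXC hXA hc₃A ha₃A
      (by rw [hυ2]; ring) hυ
    rw [hC₅]; linarith only [this]
  have hDυ : D ≤ CD * υ := by
    have h1 : D ≤ 2 * Ω * ((a₁ + ρ) + (c₁ + ρ)) := by
      rw [hD]; nlinarith only [ha₃A, hc₃C, hbwY, hbzY, hYA, hYC, hΩ, hXA, hXC]
    have h2 : (a₁ + ρ) + (c₁ + ρ) ≤ 2 * (C₅ + 1) * υ := by linarith only [hXAυ, hXCυ]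
    rw [hCD]
    have hC₅0 : 0 ≤ C₅ := by positivity
    nlinarith only [h1, h2, hΩ, hC₅0, hυ]
  have hD0 : 0 ≤ D := by rw [hD]; linarith only [ha₃, hc₃, hbw, hbz]
  -- the lower bound `ℓ - D ≥ E_A + E_C - 4Ωρ`
  set EA := a₃ * (a₂ - a₁) / (a₁ + ρ) with hEA
  set EC := c₃ * (c₂ - c₁) / (c₁ + ρ) with hEC
  have hEA0 : 0 ≤ EA := by rw [hEA]; exact div_nonneg (mul_nonneg ha₃.le (by linarith only [ha₁₂])) hXA.le
  have hEC0 : 0 ≤ EC := by rw [hEC]; exact div_nonneg (mul_nonneg hc₃.le (by linarith only [hc₁₂])) hXC.le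
  have hqA : 2 * a₃ + 2 * bw + 2 * EA - 4 * Ω * ρ ≤ (a₁ ^ 2 + bw ^ 2 + 2 * a₂ * a₃) / (a₁ + ρ) := by
    rw [hEA, le_div_iff₀ hXA]
    have e : (2 * a₃ + 2 * bw + 2 * (a₃ * (a₂ - a₁) / (a₁ + ρ)) - 4 * Ω * ρ) * (a₁ + ρ) =
        2 * a₃ * (a₁ + ρ) + 2 * bw * (a₁ + ρ) + 2 * a₃ * (a₂ - a₁) - 4 * Ω * ρ * (a₁ + ρ) := by
      field_simp
    rw [e]
    nlinarith only [sq_nonneg (a₁ - bw), mul_le_mul_of_nonneg_left ha₃A hρ.le,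
      mul_le_mul_of_nonneg_left (hbwY.trans hYA) hρ.le]
  have hqC : 2 * c₃ + 2 * bz + 2 * EC - 4 * Ω * ρ ≤ (c₁ ^ 2 + bz ^ 2 + 2 * c₂ * c₃) / (c₁ + ρ) := by
    rw [hEC, le_div_iff₀ hXC]
    have e : (2 * c₃ + 2 * bz + 2 * (c₃ * (c₂ - c₁) / (c₁ + ρ)) - 4 * Ω * ρ) * (c₁ + ρ) =
        2 * c₃ * (c₁ + ρ) + 2 * bz * (c₁ + ρ) + 2 * c₃ * (c₂ - c₁) - 4 * Ω * ρ * (c₁ + ρ) := by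
      field_simp
    rw [e]
    nlinarith only [sq_nonneg (c₁ - bz), mul_le_mul_of_nonneg_left hc₃C hρ.le,
      mul_le_mul_of_nonneg_left (hbzY.trans hYC) hρ.le]
  set N := ℓ - D with hN
  have hNE : EA + EC - 4 * Ω * ρ ≤ N := by rw [hN, hℓ, hD]; linarith only [hqA, hqC]
  -- Case B gives `E_A ≥ 2δκ a₃` or `E_C ≥ 2δκ c₃`, hence `E_A + E_C ≥ 2κυ/((2+K⁺)C₃)`
  have hE : 2 * κ * υ / ((2 + Kp) * C₃) ≤ EA + EC := by
    have htκ : κ * υ ≤ Y - υ := by linarith only [hμ]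
    rcases hB with h | h
    · -- `(a₂ - a₁) υ > 2 δ (Y - υ)(a₁ + ρ) ≥ 2δκυ (a₁+ρ)`
      have h1 : 2 * ((Y - υ) / (2 + Kp)) * (a₁ + ρ) < (a₂ - a₁) * υ := by
        linarith only [h, mul_pos hρ hυ]
      have h2 : 2 * κ / (2 + Kp) * (a₁ + ρ) * υ ≤ (a₂ - a₁) * υ := by
        have h5 : κ * υ / (2 + Kp) ≤ (Y - υ) / (2 + Kp) := div_le_div_of_nonneg_right htκ hδ0.le
        have h6 := mul_le_mul_of_nonneg_right h5 hXA.le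
        have e : 2 * κ / (2 + Kp) * (a₁ + ρ) * υ = 2 * (κ * υ / (2 + Kp) * (a₁ + ρ)) := by ring
        rw [e]; linarith only [h1, h6]
      have h3 : 2 * κ / (2 + Kp) ≤ (a₂ - a₁) / (a₁ + ρ) := by
        rw [le_div_iff₀ hXA]
        exact le_of_mul_le_mul_right h2 hυ
      have h4 : 2 * κ / (2 + Kp) * a₃ ≤ EA := by
        rw [hEA]
        calc 2 * κ / (2 + Kp) * a₃ = a₃ * (2 * κ / (2 + Kp)) := by ring
          _ ≤ a₃ * ((a₂ - a₁) / (a₁ + ρ)) := mul_le_mul_of_nonneg_left h3 ha₃.le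
          _ = a₃ * (a₂ - a₁) / (a₁ + ρ) := by ring
      have h5 : 2 * κ * υ / ((2 + Kp) * C₃) ≤ 2 * κ / (2 + Kp) * a₃ := by
        rw [div_le_iff₀ (by positivity)]
        have : 2 * κ / (2 + Kp) * a₃ * ((2 + Kp) * C₃) = 2 * κ * (C₃ * a₃) := by field_simp
        rw [this]; nlinarith only [hυa, hκ0]
      linarith only [h4, h5, hEC0]
    · have h1 : 2 * ((Y - υ) / (2 + Kp)) * (c₁ + ρ) < (c₂ - c₁) * υ := by
        linarith only [h, mul_pos hρ hυ]
      have h2 : 2 * κ / (2 + Kp) * (c₁ + ρ) * υ ≤ (c₂ - c₁) * υ := by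
        have h5 : κ * υ / (2 + Kp) ≤ (Y - υ) / (2 + Kp) := div_le_div_of_nonneg_right htκ hδ0.le
        have h6 := mul_le_mul_of_nonneg_right h5 hXC.le
        have e : 2 * κ / (2 + Kp) * (c₁ + ρ) * υ = 2 * (κ * υ / (2 + Kp) * (c₁ + ρ)) := by ring
        rw [e]; linarith only [h1, h6]
      have h3 : 2 * κ / (2 + Kp) ≤ (c₂ - c₁) / (c₁ + ρ) := by
        rw [le_div_iff₀ hXC]
        exact le_of_mul_le_mul_right h2 hυ
      have h4 : 2 * κ / (2 + Kp) * c₃ ≤ EC := by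
        rw [hEC]
        calc 2 * κ / (2 + Kp) * c₃ = c₃ * (2 * κ / (2 + Kp)) := by ring
          _ ≤ c₃ * ((c₂ - c₁) / (c₁ + ρ)) := mul_le_mul_of_nonneg_left h3 hc₃.le
          _ = c₃ * (c₂ - c₁) / (c₁ + ρ) := by ring
      have h5 : 2 * κ * υ / ((2 + Kp) * C₃) ≤ 2 * κ / (2 + Kp) * c₃ := by
        rw [div_le_iff₀ (by positivity)]
        have : 2 * κ / (2 + Kp) * c₃ * ((2 + Kp) * C₃) = 2 * κ * (C₃ * c₃) := by field_simp
        rw [this]; nlinarith only [hυc, hκ0]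
      linarith only [h4, h5, hEA0]
  -- absorb `4Ωρ`: `κυ ≥ Ks ≥ L ≥ (2+K⁺) C₃ · 8Ωρ` gives `E ≥ 8Ωρ`, so `N ≥ E/2 ≥ κυ/((2+K⁺)C₃)`
  set c' := 1 / ((2 + Kp) * C₃) with hc'
  have hc'0 : 0 < c' := by rw [hc']; positivity
  have hEκ : 2 * c' * (κ * υ) ≤ EA + EC := by
    have : 2 * c' * (κ * υ) = 2 * κ * υ / ((2 + Kp) * C₃) := by rw [hc']; field_simp
    rw [this]; exact hE
  have h8 : 8 * Ω * ρ ≤ EA + EC := by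
    have h1 : (2 + Kp) * C₃ * (8 * Ω * ρ) ≤ κ * υ := hL1.trans (hKs.trans hκυ)
    have h2 : 2 * c' * (κ * υ) ≥ 2 * c' * ((2 + Kp) * C₃ * (8 * Ω * ρ)) :=
      mul_le_mul_of_nonneg_left h1 (by positivity)
    have h3 : 2 * c' * ((2 + Kp) * C₃ * (8 * Ω * ρ)) = 16 * Ω * ρ := by rw [hc']; field_simp; ring
    linarith only [hEκ, h2, h3, mul_pos hΩ hρ]
  have hNlow : c' * (κ * υ) ≤ N := by linarith only [hNE, hEκ, h8]
  have hN0 : 0 ≤ N := (by positivity : 0 ≤ c' * (κ * υ)).trans hNlow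
  -- `ℓ = N + D`; `κ² N ≤ Ks κ N/2 ≤ Ks(1+κ)N/2` and `κ² D ≤ κ Ω CD υ ≤ Ks c' κ υ/2 ≤ Ks N/2`
  have hℓND : ℓ = N + D := by rw [hN]; ring
  rw [hℓND]
  have h1 : κ ^ 2 * N ≤ Ks * (1 + κ) * N / 2 := by
    have : κ ^ 2 ≤ Ks * (1 + κ) / 2 := by nlinarith only [hκKs, hκ0]
    nlinarith only [this, hN0]
  have h2 : κ ^ 2 * D ≤ Ks * N / 2 := by
    have h3 : κ ^ 2 * D ≤ κ * Ω * (CD * υ) := by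
      nlinarith only [mul_le_mul hκΩ hDυ hD0 hΩ.le, hκ0]
    -- `Ω CD ≤ Ks c'/2` from `hL2`
    have h4 : 2 * Ω * CD ≤ Ks * c' := by
      have h5 : (2 + Kp) * C₃ * (4 * Ω * CD) ≤ Ks := by rw [hCD, hC₅]; exact hL2.trans hKs
      rw [hc']
      rw [show Ks * (1 / ((2 + Kp) * C₃)) = Ks / ((2 + Kp) * C₃) by ring, le_div_iff₀ (by positivity)]
      have hCD0 : 0 < CD := by rw [hCD]; positivity
      have h0 : 0 ≤ Ω * CD * ((2 + Kp) * C₃) := by positivity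
      linarith only [h5, h0]
    have h6 : κ * Ω * (CD * υ) ≤ Ks * (c' * (κ * υ)) / 2 := by
      have := mul_le_mul_of_nonneg_right h4 (le_of_lt (mul_pos hκ0 hυ))
      linarith only [this]
    have h7 : Ks * (c' * (κ * υ)) / 2 ≤ Ks * N / 2 := by
      have := mul_le_mul_of_nonneg_left hNlow hKs0.le
      linarith only [this]
    linarith only [h3, h6, h7]
  have h9 : Ks * (1 + κ) * N / 2 + Ks * N / 2 ≤ Ks * (1 + κ) * N := by
    have h0 : 0 ≤ Ks * κ * N := mul_nonneg (mul_nonneg hKs0.le hκ0.le) hN0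
    nlinarith only [h0]
  calc κ ^ 2 * (N + D) = κ ^ 2 * N + κ ^ 2 * D := by ring
    _ ≤ Ks * (1 + κ) * N / 2 + Ks * N / 2 := add_le_add h1 h2
    _ ≤ Ks * (1 + κ) * N := h9

end HamiltonODE

end Literature.Geometry.Riemannian

end
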